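import Mathlib.Tactic.Ring
import HarnessLib

/-!
# `NoHeavyLowerTail` (stmt-CriticalPhenomena-4575) — (L1) face-first: the GRADIENT of `polL₁` on the cut-vertex face (definition)

Definitions file (prover prim-l12-p6, line P6; `--supports stmt-CriticalPhenomena-4575`).  Pure algebra, nothing asserted.
`faceGrad μQ μAB μAY μBY μT r₀ r₁ q₀ … q₁₄` is the linear form `q ↦ ∇polL₁(x⁰)·q` at the face point `x⁰ = μ ⊗ (r₀,r₁)` (`b` separates `{a,y}`
from `c`; `μ` = law of `(a,b,y)` on the near side in the cells `a|b|y, ab|y, ay|b, a|by, aby`; `(r₀,r₁)` = masses of `b≁c, b~c`), with the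
fifteen partial derivatives `∂polL₁/∂cell (x⁰)` written out as explicit bidegree-`(2,2)` forms in `(μ, r)` (computed by exact computer algebra,
seat prim-l12-p6 work/py/normal.py; certified against `polL₁` by `CubicFourPoint.polL₁_faceSD` in `…FourPointFaceTwoBlock`).  The direction
`q` is indexed by the 15 cells in the binder order of `CubicThreePointStep.threeB₁_polarization`
(`a|b|c|y, a|b|cy, a|by|c, a|bc|y, ay|b|c, ac|b|y, ab|c|y, a|bcy, ay|bc, ac|by, acy|b, ab|cy, aby|c, abc|y, abcy`).
[cite: GladkovZimin2024HK, §4 (one-coordinate decomposition; the form is this programme's)]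
-/

namespace Summit.CriticalPhenomena.PercolationContinuityZ3.Theorems

namespace CubicFourPoint

variable {R : Type*} [CommRing R]

set_option maxRecDepth 20000 in
set_option maxHeartbeats 4000000 in
/-- **Gradient of (L1) on the cut-vertex face**: `faceGrad μ r q = Σ_k (∂polL₁/∂x_k)(μ⊗r)·q_k`, the normal-derivative linear form of
`polL₁` at the face point `μ ⊗ (r₀,r₁)` applied to a direction `q` (15 cells, standard order). [this work] -/
def faceGrad (μQ μAB μAY μBY μT r₀ r₁ q0 q1 q2 q3 q4 q5 q6 q7 q8 q9 q10 q11 q12 q13 q14 : R) : R :=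
    (4 * μT * μAB * r₀ * r₁ + 8 * μT * μAB * r₁ ^ 2 + 2 * μT * μAY * r₀ * r₁ + 2 * μT * μAY * r₁ ^ 2 + 3 * μT * μBY * r₀ * r₁ + 5 * μT * μBY * r₁ ^ 2 + 2 * μT * μQ * r₀ * r₁ + 2 * μT * μQ * r₁ ^ 2 + 2 * μT ^ 2 * r₀ * r₁ + 4 * μT ^ 2 * r₁ ^ 2 + 2 * μAB * μAY * r₀ * r₁ + 2 * μAB * μAY * r₁ ^ 2 + 3 * μAB * μBY * r₀ * r₁ + 5 * μAB * μBY * r₁ ^ 2 + 2 * μAB * μQ * r₀ * r₁ + 2 * μAB * μQ * r₁ ^ 2 + 2 * μAB ^ 2 * r₀ * r₁ + 4 * μAB ^ 2 * r₁ ^ 2 + μAY * μBY * r₀ * r₁ + μAY * μBY * r₁ ^ 2 + μBY * μQ * r₀ * r₁ + μBY * μQ * r₁ ^ 2 + μBY ^ 2 * r₀ * r₁ + μBY ^ 2 * r₁ ^ 2) * q0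
    + (-2 * μT * μAB * r₀ * r₁ - 2 * μT * μAB * r₀ ^ 2 + 4 * μT * μAB * r₁ ^ 2 - 2 * μT * μAY * r₀ * r₁ - μT * μAY * r₀ ^ 2 - μT * μAY * r₁ ^ 2 - μT * μBY * r₀ * r₁ - μT * μBY * r₀ ^ 2 + 2 * μT * μBY * r₁ ^ 2 - 2 * μT * μQ * r₀ * r₁ - μT * μQ * r₀ ^ 2 - μT * μQ * r₁ ^ 2 - μT ^ 2 * r₀ * r₁ - μT ^ 2 * r₀ ^ 2 + 2 * μT ^ 2 * r₁ ^ 2 - 2 * μAB * μAY * r₀ * r₁ - μAB * μAY * r₀ ^ 2 - μAB * μAY * r₁ ^ 2 - μAB * μBY * r₀ * r₁ - μAB * μBY * r₀ ^ 2 + 2 * μAB * μBY * r₁ ^ 2 - 2 * μAB * μQ * r₀ * r₁ - μAB * μQ * r₀ ^ 2 - μAB * μQ * r₁ ^ 2 - μAB ^ 2 * r₀ * r₁ - μAB ^ 2 * r₀ ^ 2 + 2 * μAB ^ 2 * r₁ ^ 2 - μAY * μBY * r₀ * r₁ - μAY * μBY * r₁ ^ 2 - 2 * μAY * μQ * r₀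 * r₁ - 2 * μAY * μQ * r₁ ^ 2 - μAY ^ 2 * r₀ * r₁ - μAY ^ 2 * r₁ ^ 2 - μBY * μQ * r₀ * r₁ - μBY * μQ * r₁ ^ 2 - μQ ^ 2 * r₀ * r₁ - μQ ^ 2 * r₁ ^ 2) * q1
    + (2 * μT * μAB * r₀ * r₁ + 4 * μT * μAB * r₁ ^ 2 - μT * μAY * r₁ ^ 2 + μT * μBY * r₀ * r₁ + 2 * μT * μBY * r₁ ^ 2 - μT * μQ * r₁ ^ 2 + μT ^ 2 * r₀ * r₁ + 2 * μT ^ 2 * r₁ ^ 2 - μAB * μAY * r₁ ^ 2 + μAB * μBY * r₀ * r₁ + 2 * μAB * μBY * r₁ ^ 2 - μAB * μQ * r₁ ^ 2 + μAB ^ 2 * r₀ * r₁ + 2 * μAB ^ 2 * r₁ ^ 2 - μAY * μBY * r₀ * r₁ - μAY * μBY * r₁ ^ 2 - 2 * μAY * μQ * r₀ * r₁ - 2 * μAY * μQ * r₁ ^ 2 - μAY ^ 2 * r₀ * r₁ - μAY ^ 2 * r₁ ^ 2 - μBY * μQ * r₀ * r₁ - μBY * μQ * r₁ ^ 2 - μQ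 ^ 2 * r₀ * r₁ - μQ ^ 2 * r₁ ^ 2) * q2
    + (-8 * μT * μAB * r₀ * r₁ - 4 * μT * μAB * r₀ ^ 2 - 2 * μT * μAY * r₀ * r₁ - 2 * μT * μAY * r₀ ^ 2 - 5 * μT * μBY * r₀ * r₁ - 3 * μT * μBY * r₀ ^ 2 - 2 * μT * μQ * r₀ * r₁ - 2 * μT * μQ * r₀ ^ 2 - 4 * μT ^ 2 * r₀ * r₁ - 2 * μT ^ 2 * r₀ ^ 2 - 2 * μAB * μAY * r₀ * r₁ - 2 * μAB * μAY * r₀ ^ 2 - 5 * μAB * μBY * r₀ * r₁ - 3 * μAB * μBY * r₀ ^ 2 - 2 * μAB * μQ * r₀ * r₁ - 2 * μAB * μQ * r₀ ^ 2 - 4 * μAB ^ 2 * r₀ * r₁ - 2 * μAB ^ 2 * r₀ ^ 2 - μAY * μBY * r₀ * r₁ - μAY * μBY * r₀ ^ 2 - μBY * μQ * r₀ * r₁ - μBY * μQ * r₀ ^ 2 - μBY ^ 2 * r₀ * r₁ - μBY ^ 2 * r₀ ^ 2) * q3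
    + (4 * μT * μAB * r₀ * r₁ + 8 * μT * μAB * r₁ ^ 2 + 2 * μT * μAY * r₀ * r₁ + 2 * μT * μAY * r₁ ^ 2 + 3 * μT * μBY * r₀ * r₁ + 5 * μT * μBY * r₁ ^ 2 + 2 * μT * μQ * r₀ * r₁ + 2 * μT * μQ * r₁ ^ 2 + 2 * μT ^ 2 * r₀ * r₁ + 4 * μT ^ 2 * r₁ ^ 2 + 2 * μAB * μAY * r₀ * r₁ + 2 * μAB * μAY * r₁ ^ 2 + 3 * μAB * μBY * r₀ * r₁ + 5 * μAB * μBY * r₁ ^ 2 + 2 * μAB * μQ * r₀ * r₁ + 2 * μAB * μQ * r₁ ^ 2 + 2 * μAB ^ 2 * r₀ * r₁ + 4 * μAB ^ 2 * r₁ ^ 2 + μAY * μBY * r₀ * r₁ + μAY * μBY * r₁ ^ 2 + μBY * μQ * r₀ * r₁ + μBY * μQ * r₁ ^ 2 + μBY ^ 2 * r₀ * r₁ + μBY ^ 2 * r₁ ^ 2) * q4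
    + (-8 * μT * μAB * r₀ * r₁ - 4 * μT * μAB * r₀ ^ 2 - 6 * μT * μAY * r₀ * r₁ - 2 * μT * μAY * r₀ ^ 2 - 4 * μT * μAY * r₁ ^ 2 - 7 * μT * μBY * r₀ * r₁ - 3 * μT * μBY * r₀ ^ 2 - 2 * μT * μBY * r₁ ^ 2 - 6 * μT * μQ * r₀ * r₁ - 2 * μT * μQ * r₀ ^ 2 - 4 * μT * μQ * r₁ ^ 2 - 4 * μT ^ 2 * r₀ * r₁ - 2 * μT ^ 2 * r₀ ^ 2 - 6 * μAB * μAY * r₀ * r₁ - 2 * μAB * μAY * r₀ ^ 2 - 4 * μAB * μAY * r₁ ^ 2 - 7 * μAB * μBY * r₀ * r₁ - 3 * μAB * μBY * r₀ ^ 2 - 2 * μAB * μBY * r₁ ^ 2 - 6 * μAB * μQ * r₀ * r₁ - 2 * μAB * μQ * r₀ ^ 2 - 4 * μAB * μQ * r₁ ^ 2 - 4 * μAB ^ 2 * r₀ * r₁ - 2 * μAB ^ 2 * r₀ ^ 2 - 5 * μAY * μBY * r₀ * r₁ - μAY * μBY * r₀ ^ 2 - 4 * μAY * μBY * r₁ ^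 2 - 4 * μAY * μQ * r₀ * r₁ - 4 * μAY * μQ * r₁ ^ 2 - 2 * μAY ^ 2 * r₀ * r₁ - 2 * μAY ^ 2 * r₁ ^ 2 - 5 * μBY * μQ * r₀ * r₁ - μBY * μQ * r₀ ^ 2 - 4 * μBY * μQ * r₁ ^ 2 - 3 * μBY ^ 2 * r₀ * r₁ - μBY ^ 2 * r₀ ^ 2 - 2 * μBY ^ 2 * r₁ ^ 2 - 2 * μQ ^ 2 * r₀ * r₁ - 2 * μQ ^ 2 * r₁ ^ 2) * q5
    + (-2 * μT * μAY * r₀ * r₁ - 4 * μT * μAY * r₁ ^ 2 - μT * μBY * r₀ * r₁ - 2 * μT * μBY * r₁ ^ 2 - 2 * μT * μQ * r₀ * r₁ - 4 * μT * μQ * r₁ ^ 2 - 2 * μAB * μAY * r₀ * r₁ - 4 * μAB * μAY * r₁ ^ 2 - μAB * μBY * r₀ * r₁ - 2 * μAB * μBY * r₁ ^ 2 - 2 * μAB * μQ * r₀ * r₁ - 4 * μAB * μQ * r₁ ^ 2 - 3 * μAY * μBY * r₀ * r₁ - 4 * μAY * μBY * r₁ ^ 2 - 4 * μAY * μQ *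 r₀ * r₁ - 4 * μAY * μQ * r₁ ^ 2 - 2 * μAY ^ 2 * r₀ * r₁ - 2 * μAY ^ 2 * r₁ ^ 2 - 3 * μBY * μQ * r₀ * r₁ - 4 * μBY * μQ * r₁ ^ 2 - μBY ^ 2 * r₀ * r₁ - 2 * μBY ^ 2 * r₁ ^ 2 - 2 * μQ ^ 2 * r₀ * r₁ - 2 * μQ ^ 2 * r₁ ^ 2) * q6
    + (-4 * μT * μAB * r₀ * r₁ - 2 * μT * μAB * r₀ ^ 2 + μT * μAY * r₀ * r₁ - 2 * μT * μBY * r₀ * r₁ - μT * μBY * r₀ ^ 2 + μT * μQ * r₀ * r₁ - 2 * μT ^ 2 * r₀ * r₁ - μT ^ 2 * r₀ ^ 2 + μAB * μAY * r₀ * r₁ - 2 * μAB * μBY * r₀ * r₁ - μAB * μBY * r₀ ^ 2 + μAB * μQ * r₀ * r₁ - 2 * μAB ^ 2 * r₀ * r₁ - μAB ^ 2 * r₀ ^ 2 + μAY * μBY * r₀ * r₁ + μAY * μBY * r₀ ^ 2 + 2 * μAY * μQ * r₀ * r₁ + 2 * μAY * μQ * r₀ ^ 2 + μAY ^ 2 *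 r₀ * r₁ + μAY ^ 2 * r₀ ^ 2 + μBY * μQ * r₀ * r₁ + μBY * μQ * r₀ ^ 2 + μQ ^ 2 * r₀ * r₁ + μQ ^ 2 * r₀ ^ 2) * q7
    + (-8 * μT * μAB * r₀ * r₁ - 4 * μT * μAB * r₀ ^ 2 - 2 * μT * μAY * r₀ * r₁ - 2 * μT * μAY * r₀ ^ 2 - 5 * μT * μBY * r₀ * r₁ - 3 * μT * μBY * r₀ ^ 2 - 2 * μT * μQ * r₀ * r₁ - 2 * μT * μQ * r₀ ^ 2 - 4 * μT ^ 2 * r₀ * r₁ - 2 * μT ^ 2 * r₀ ^ 2 - 2 * μAB * μAY * r₀ * r₁ - 2 * μAB * μAY * r₀ ^ 2 - 5 * μAB * μBY * r₀ * r₁ - 3 * μAB * μBY * r₀ ^ 2 - 2 * μAB * μQ * r₀ * r₁ - 2 * μAB * μQ * r₀ ^ 2 - 4 * μAB ^ 2 * r₀ * r₁ - 2 * μAB ^ 2 * r₀ ^ 2 - μAY * μBY * r₀ * r₁ - μAY * μBY * r₀ ^ 2 - μBY * μQ * r₀ * r₁ - μBY * μQ * r₀ ^ 2 - μBY ^ 2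 * r₀ * r₁ - μBY ^ 2 * r₀ ^ 2) * q8
    + (-4 * μT * μAB * r₀ * r₁ - 2 * μT * μAB * r₀ ^ 2 - 2 * μT * μAY * r₀ * r₁ - 3 * μT * μAY * r₁ ^ 2 - 3 * μT * μBY * r₀ * r₁ - μT * μBY * r₀ ^ 2 - μT * μBY * r₁ ^ 2 - 2 * μT * μQ * r₀ * r₁ - 3 * μT * μQ * r₁ ^ 2 - 2 * μT ^ 2 * r₀ * r₁ - μT ^ 2 * r₀ ^ 2 - 2 * μAB * μAY * r₀ * r₁ - 3 * μAB * μAY * r₁ ^ 2 - 3 * μAB * μBY * r₀ * r₁ - μAB * μBY * r₀ ^ 2 - μAB * μBY * r₁ ^ 2 - 2 * μAB * μQ * r₀ * r₁ - 3 * μAB * μQ * r₁ ^ 2 - 2 * μAB ^ 2 * r₀ * r₁ - μAB ^ 2 * r₀ ^ 2 - μAY * μBY * r₀ * r₁ + μAY * μBY * r₀ ^ 2 - 2 * μAY * μBY * r₁ ^ 2 + 2 * μAY * μQ * r₀ ^ 2 - 2 * μAY * μQ * r₁ ^ 2 + μAY ^ 2 * r₀ ^ 2 - μAY ^ 2 *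 r₁ ^ 2 - μBY * μQ * r₀ * r₁ + μBY * μQ * r₀ ^ 2 - 2 * μBY * μQ * r₁ ^ 2 - μBY ^ 2 * r₀ * r₁ - μBY ^ 2 * r₁ ^ 2 + μQ ^ 2 * r₀ ^ 2 - μQ ^ 2 * r₁ ^ 2) * q9
    + (-8 * μT * μAB * r₀ * r₁ - 4 * μT * μAB * r₀ ^ 2 - 6 * μT * μAY * r₀ * r₁ - 2 * μT * μAY * r₀ ^ 2 - 4 * μT * μAY * r₁ ^ 2 - 7 * μT * μBY * r₀ * r₁ - 3 * μT * μBY * r₀ ^ 2 - 2 * μT * μBY * r₁ ^ 2 - 6 * μT * μQ * r₀ * r₁ - 2 * μT * μQ * r₀ ^ 2 - 4 * μT * μQ * r₁ ^ 2 - 4 * μT ^ 2 * r₀ * r₁ - 2 * μT ^ 2 * r₀ ^ 2 - 6 * μAB * μAY * r₀ * r₁ - 2 * μAB * μAY * r₀ ^ 2 - 4 * μAB * μAY * r₁ ^ 2 - 7 * μAB * μBY * r₀ * r₁ - 3 * μAB * μBY * r₀ ^ 2 - 2 * μAB * μBY * r₁ ^ 2 - 6 * μAB * μQ * r₀ * r₁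 - 2 * μAB * μQ * r₀ ^ 2 - 4 * μAB * μQ * r₁ ^ 2 - 4 * μAB ^ 2 * r₀ * r₁ - 2 * μAB ^ 2 * r₀ ^ 2 - 5 * μAY * μBY * r₀ * r₁ - μAY * μBY * r₀ ^ 2 - 4 * μAY * μBY * r₁ ^ 2 - 4 * μAY * μQ * r₀ * r₁ - 4 * μAY * μQ * r₁ ^ 2 - 2 * μAY ^ 2 * r₀ * r₁ - 2 * μAY ^ 2 * r₁ ^ 2 - 5 * μBY * μQ * r₀ * r₁ - μBY * μQ * r₀ ^ 2 - 4 * μBY * μQ * r₁ ^ 2 - 3 * μBY ^ 2 * r₀ * r₁ - μBY ^ 2 * r₀ ^ 2 - 2 * μBY ^ 2 * r₁ ^ 2 - 2 * μQ ^ 2 * r₀ * r₁ - 2 * μQ ^ 2 * r₁ ^ 2) * q10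
    + (μT * μAY * r₀ ^ 2 - 3 * μT * μAY * r₁ ^ 2 + μT * μBY * r₀ * r₁ + μT * μBY * r₀ ^ 2 - μT * μBY * r₁ ^ 2 + μT * μQ * r₀ ^ 2 - 3 * μT * μQ * r₁ ^ 2 + μAB * μAY * r₀ ^ 2 - 3 * μAB * μAY * r₁ ^ 2 + μAB * μBY * r₀ * r₁ + μAB * μBY * r₀ ^ 2 - μAB * μBY * r₁ ^ 2 + μAB * μQ * r₀ ^ 2 - 3 * μAB * μQ * r₁ ^ 2 + μAY * μBY * r₀ * r₁ + 2 * μAY * μBY * r₀ ^ 2 - 2 * μAY * μBY * r₁ ^ 2 + 2 * μAY * μQ * r₀ ^ 2 - 2 * μAY * μQ * r₁ ^ 2 + μAY ^ 2 * r₀ ^ 2 - μAY ^ 2 * r₁ ^ 2 + μBY * μQ * r₀ * r₁ + 2 * μBY * μQ * r₀ ^ 2 - 2 * μBY * μQ * r₁ ^ 2 + μBY ^ 2 * r₀ * r₁ + μBY ^ 2 * r₀ ^ 2 - μBY ^ 2 * r₁ ^ 2 + μQ ^ 2 * r₀ ^ 2 - μQ ^ 2 * r₁ ^ 2) * q11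
    + (-2 * μT * μAY * r₀ * r₁ - 4 * μT * μAY * r₁ ^ 2 - μT * μBY * r₀ * r₁ - 2 * μT * μBY * r₁ ^ 2 - 2 * μT * μQ * r₀ * r₁ - 4 * μT * μQ * r₁ ^ 2 - 2 * μAB * μAY * r₀ * r₁ - 4 * μAB * μAY * r₁ ^ 2 - μAB * μBY * r₀ * r₁ - 2 * μAB * μBY * r₁ ^ 2 - 2 * μAB * μQ * r₀ * r₁ - 4 * μAB * μQ * r₁ ^ 2 - 3 * μAY * μBY * r₀ * r₁ - 4 * μAY * μBY * r₁ ^ 2 - 4 * μAY * μQ * r₀ * r₁ - 4 * μAY * μQ * r₁ ^ 2 - 2 * μAY ^ 2 * r₀ * r₁ - 2 * μAY ^ 2 * r₁ ^ 2 - 3 * μBY * μQ * r₀ * r₁ - 4 * μBY * μQ * r₁ ^ 2 - μBY ^ 2 * r₀ * r₁ - 2 * μBY ^ 2 * r₁ ^ 2 - 2 * μQ ^ 2 * r₀ * r₁ - 2 * μQ ^ 2 * r₁ ^ 2) * q12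
    + (4 * μT * μAY * r₀ * r₁ + 2 * μT * μAY * r₀ ^ 2 + 2 * μT * μBY * r₀ * r₁ + μT * μBY * r₀ ^ 2 + 4 * μT * μQ * r₀ * r₁ + 2 * μT * μQ * r₀ ^ 2 + 4 * μAB * μAY * r₀ * r₁ + 2 * μAB * μAY * r₀ ^ 2 + 2 * μAB * μBY * r₀ * r₁ + μAB * μBY * r₀ ^ 2 + 4 * μAB * μQ * r₀ * r₁ + 2 * μAB * μQ * r₀ ^ 2 + 4 * μAY * μBY * r₀ * r₁ + 3 * μAY * μBY * r₀ ^ 2 + 4 * μAY * μQ * r₀ * r₁ + 4 * μAY * μQ * r₀ ^ 2 + 2 * μAY ^ 2 * r₀ * r₁ + 2 * μAY ^ 2 * r₀ ^ 2 + 4 * μBY * μQ * r₀ * r₁ + 3 * μBY * μQ * r₀ ^ 2 + 2 * μBY ^ 2 * r₀ * r₁ + μBY ^ 2 * r₀ ^ 2 + 2 * μQ ^ 2 * r₀ * r₁ + 2 * μQ ^ 2 * r₀ ^ 2) * q13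
    + (4 * μT * μAY * r₀ * r₁ + 2 * μT * μAY * r₀ ^ 2 + 2 * μT * μBY * r₀ * r₁ + μT * μBY * r₀ ^ 2 + 4 * μT * μQ * r₀ * r₁ + 2 * μT * μQ * r₀ ^ 2 + 4 * μAB * μAY * r₀ * r₁ + 2 * μAB * μAY * r₀ ^ 2 + 2 * μAB * μBY * r₀ * r₁ + μAB * μBY * r₀ ^ 2 + 4 * μAB * μQ * r₀ * r₁ + 2 * μAB * μQ * r₀ ^ 2 + 4 * μAY * μBY * r₀ * r₁ + 3 * μAY * μBY * r₀ ^ 2 + 4 * μAY * μQ * r₀ * r₁ + 4 * μAY * μQ * r₀ ^ 2 + 2 * μAY ^ 2 * r₀ * r₁ + 2 * μAY ^ 2 * r₀ ^ 2 + 4 * μBY * μQ * r₀ * r₁ + 3 * μBY * μQ * r₀ ^ 2 + 2 * μBY ^ 2 * r₀ * r₁ + μBY ^ 2 * r₀ ^ 2 + 2 * μQ ^ 2 * r₀ * r₁ + 2 * μQ ^ 2 * r₀ ^ 2) * q14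

end CubicFourPoint

end Summit.CriticalPhenomena.PercolationContinuityZ3.Theorems
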